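import Mathlib.NumberTheory.LegendreSymbol.Basic
import Mathlib.RingTheory.PowerSeries.Basic
import Mathlib.Tactic.LinearCombination
import Mathlib.Tactic.Positivity
import HarnessLib

/-!
# Crux `PrintCFram.BottomClassIndexLawFiveLe` (stmt-BirchSwinnertonDyer-20372), line `eisenstein-resource-bdp-line` (registry v21):
# THE θ-CYCLE ENGINE OF `stub_atP` IN THE KERNEL — a non-zero mod-`p` form of weight `k + (p+1)/2`,
# `k ∈ {(p+1)/4, (3p−1)/4}`, with zero constant term has non-zero coefficients in BOTH Legendre classes at `p`
# (cell `bsd-print-cfram`, width seat `bsd-line-cfram-p1-w8` g6; THEOREMS ONLY, `--supports` 20372; BSD is not proved by any of this)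

HONEST FRAMING. Nothing here is a statement about elliptic curves, `L`-values or BSD; no registered stub is closed. Registry
v21 of the line (LEAD g12) carries `stub_atP` = (AtP⁶), «the at-`p` rung»: a unit field factor of SOME `m`-admissible imaginary
quadratic field propagates to one in which `p` SPLITS. The LEAD's derivation (`Lines/eisenstein-resource-bdp-line-lead-g12.md` §3.4,
checked on paper by w8 g5) has two halves: (T1) the `m`-cut Cohen–Eisenstein series times `θ₀^p` is a holomorphic form of INTEGRAL
weight `κ = k + (p+1)/2` on `Γ₁(4N)`, `p ∤ N`, whose non-zero coefficients mod `p` sit in the Legendre classes of the field factors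
(Cohen 1975, Shimura 1973); (T4) **θ-cycles**: a non-zero mod-`p` form of that weight with zero constant term has unit coefficients
in BOTH Legendre classes — from the filtration calculus of Serre / Swinnerton-Dyer (level one) and Katz (level `N ≥ 3`, `p ∤ N`):
`w(f) ≤` weight, `≡` weight `(mod p−1)`; `Θ = q d/dq` raises the weight by `p + 1`; `p ∤ w(f) ⟹ Θ f ≠ 0 ∧ w(Θ f) = w(f) + p + 1`
[Katz 1977, Thm. (2)]; weight-`0` forms are constants. The LEAD's §8 lists (T4) as «could be typed as ONE named fact». THIS FILE
PROVES (T4) IN THE KERNEL INSTEAD, for an ARBITRARY field `𝔽` of characteristic `p` and an ARBITRARY family of `𝔽`-subspaces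
`M j ⊆ 𝔽⟦q⟧` («mod-`p` forms of weight `j`, by `q`-expansion») with a filtration `w` and an operator `Θ` acting as `q d/dq`, under
exactly those printed facts taken as HYPOTHESES (`exists_coeff_ne_zero_of_legendreSym_eq`). No modular form is constructed; the
hypotheses are discharged by nobody yet (typing owed: Katz 1973 Cor. 4.4.2, Katz 1977 Thm. (1)–(2), `M₀ =` constants, for
`Γ₁(N)`-forms over `𝔽̄_p`). With this file `stub_atP` ⟸ (T1) ∧ «mod-`p` forms on `Γ₁(N)` satisfy the five hypotheses» ∧ the
elementary descent of lead-g12 §3.3 — the stub's «print-derivable» status no longer rests on an unformalised θ-cycle argument.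

THE PROOF (numbers; `p = 4u + 3`, `u ≥ 1`, half period `L = (p−1)/2 = 2u+1`, `W(i) := w(Θ^i f)`). If the class `ε` carries
no non-zero coefficient of `f`, Euler's criterion gives `Θ^{i+L} f = −ε·Θ^i f` for `i ≥ 1`, hence `W(i+L) = W(i)` (`i ≥ 1`).
The weight pins `w(f)` (`3u+3`, resp. `5u+4` or `u+2`; the value `0` at `p = 7` is excluded by the constant term), `p ∤ w(f)`, so
`Θ f ≠ 0` and Katz's theorem gives the RISING LAW `p ∤ W(i) ⟹ W(i+1) = W(i) + p + 1`, with `W(i+1) ≤ W(i) + p + 1`,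
`W(i+1) ≡ W(i) + 2 (mod p−1)` always. LOW case: `W(1) = 7u+7` rises to `W(u) = p(u+1)`; `W(u+1) = (u+1)(4u+7) − s(4u+2)`,
`s ≤ 2u+2` by non-negativity, `s = 2u+2` absurd, and for `s ≤ 2u+1` a further rise of `2u` steps makes `W(3u+1) = W(u)` absurd.
HIGH case: from `W(1) ∈ {9u+8, 5u+6}` the residues stay in `(0,p)` for `2u+1` steps, so `W(1+L) ≠ W(1)`. (Lead-g12 §3.4
with the two drops `s₁ = s₂ = (p+1)/2` replaced by the one inequality actually needed; the drop law «`p ∣ w ⟹ w(Θf) ≤ w+2`» and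
Katz's `ker Θ` theorem are NOT used.) beyond-print theorem: NO (θ-cycle bookkeeping; printed theorem of this type:
Ahlgren–Boylan 2003 Thm. 3).

References: [Katz1977] Thm. (1)–(2) and Cor. (1)–(5) (LNM 601 pp. 55–56); [Katz1973] §4.4 (LNM 350); [SwinnertonDyer1973] §3
(LNM 350 pp. 19–33); [Jochnowitz1982] §§1–4; [AhlgrenBoylan2003] Thm. 3; [Cohen1975] Thm. 3.1; crux notes
`Lines/eisenstein-resource-bdp-line-lead-g12.md` §§3.4, 8.
-/

set_option autoImplicit false
-- summit-side namespace `Summit.BirchSwinnertonDyer.BirchSwinnertonDyer.…` (single-conjunct summit, D-0017 layout)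
set_option linter.dupNamespace false

noncomputable section

open scoped Classical

namespace Summit.BirchSwinnertonDyer.BirchSwinnertonDyer.Theorems.PrintCFram.ThetaCycle

open PowerSeries

variable {𝔽 : Type*} [Field 𝔽]

/-! ## §1 Coefficient calculus of an operator acting as `q d/dq` on `𝔽⟦q⟧` -/

/-- **Iterates of `Θ = q d/dq` on coefficients.** If `Θ` multiplies the `n`-th coefficient by `n`, then `Θ^i` multiplies it
by `n^i`. [folklore] -/
theorem coeff_theta_pow_apply (Θ : PowerSeries 𝔽 →ₗ[𝔽] PowerSeries 𝔽)
    (hΘ : ∀ (g : PowerSeries 𝔽) (n : ℕ), coeff n (Θ g) = (n : 𝔽) * coeff n g)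
    (g : PowerSeries 𝔽) (i n : ℕ) :
    coeff n ((Θ ^ i) g) = (n : 𝔽) ^ i * coeff n g := by
  induction i with
  | zero => simp
  | succ i ih =>
    rw [pow_succ', Module.End.mul_apply, hΘ, ih]
    ring

/-- **Euler's criterion in a field of characteristic `p`.** For `n : ℕ`, `n^{(p−1)/2} = (n/p)` in `𝔽` (`(n/p)` the Legendre
symbol, `= 0` when `p ∣ n`). [folklore; Mathlib `legendreSym.eq_pow` transported along `ZMod p → 𝔽`] -/
theorem natCast_pow_div_two_eq_legendreSym (p : ℕ) [Fact p.Prime] [CharP 𝔽 p] (n : ℕ) :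
    ((n : 𝔽)) ^ (p / 2) = ((legendreSym p n : ℤ) : 𝔽) := by
  have h := congrArg (ZMod.castHom (dvd_refl p) 𝔽) (legendreSym.eq_pow p (n : ℤ))
  simpa [map_intCast, Int.cast_natCast] using h.symm

/-- **The Legendre symbol of `n` with `p ∤ n` is `±1`.** [folklore] -/
theorem legendreSym_natCast_eq_one_or_eq_neg_one {p : ℕ} [Fact p.Prime] {n : ℕ} (hn : ¬ p ∣ n) :
    legendreSym p n = 1 ∨ legendreSym p n = -1 :=
  legendreSym.eq_one_or_neg_one p (by
    rw [Int.cast_natCast, Ne, ZMod.natCast_eq_zero_iff]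
    exact hn)

/-- **The half-period relation.** If `Θ` acts as `q d/dq` on `𝔽⟦q⟧` (`char 𝔽 = p`) and the power series `f` has NO non-zero
coefficient in the Legendre class `ε ∈ {±1}` at `p`, then `Θ^{i + (p−1)/2} f = −ε · Θ^i f` for every `i ≥ 1`: by Euler's criterion
`Θ^{(p−1)/2}` multiplies the `n`-th coefficient by `(n/p)`, which is `−ε` wherever `f` has a non-zero coefficient prime to `p`, and
the coefficients at `p ∣ n` are killed by `Θ^i`, `i ≥ 1`, on both sides. [folklore; lead-g12 §3.4 (b)] -/
theorem theta_pow_add_div_two_eq_neg_smul {p : ℕ} [Fact p.Prime] [CharP 𝔽 p]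
    (Θ : PowerSeries 𝔽 →ₗ[𝔽] PowerSeries 𝔽)
    (hΘ : ∀ (g : PowerSeries 𝔽) (n : ℕ), coeff n (Θ g) = (n : 𝔽) * coeff n g)
    {f : PowerSeries 𝔽} {ε : ℤ} (hε : ε = 1 ∨ ε = -1)
    (hsupp : ∀ n : ℕ, legendreSym p n = ε → coeff n f = 0) {i : ℕ} (hi : 1 ≤ i) :
    (Θ ^ (i + p / 2)) f = (-(ε : 𝔽)) • (Θ ^ i) f := by
  ext n
  rw [coeff_theta_pow_apply Θ hΘ, PowerSeries.coeff_smul, coeff_theta_pow_apply Θ hΘ, smul_eq_mul]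
  by_cases hpn : p ∣ n
  · have h0 : (n : 𝔽) = 0 := (CharP.cast_eq_zero_iff 𝔽 p n).2 hpn
    have hi0 : i ≠ 0 := by omega
    have hi1 : i + p / 2 ≠ 0 := by omega
    rw [h0, zero_pow hi1, zero_pow hi0, zero_mul, mul_zero]
  · have hleg := natCast_pow_div_two_eq_legendreSym (𝔽 := 𝔽) p n
    rcases legendreSym_natCast_eq_one_or_eq_neg_one hpn with h1 | h1
    · by_cases hε1 : ε = 1
      · rw [hsupp n (h1.trans hε1.symm), mul_zero, mul_zero, mul_zero]
      · have hε' : ε = -1 := hε.resolve_left hε1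
        rw [pow_add, hleg, h1, hε']
        push_cast
        ring
    · by_cases hε1 : ε = -1
      · rw [hsupp n (h1.trans hε1.symm), mul_zero, mul_zero, mul_zero]
      · have hε' : ε = 1 := hε.resolve_right hε1
        rw [pow_add, hleg, h1, hε']
        push_cast
        ring

/-- **All `Θ`-iterates of `f` are non-zero once `Θ f ≠ 0`** (`Θ f ≠ 0` exhibits a non-zero coefficient at some `n` with
`n ≠ 0` in `𝔽`, which survives multiplication by `n^i`). [folklore] -/
theorem theta_pow_apply_ne_zero (Θ : PowerSeries 𝔽 →ₗ[𝔽] PowerSeries 𝔽)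
    (hΘ : ∀ (g : PowerSeries 𝔽) (n : ℕ), coeff n (Θ g) = (n : 𝔽) * coeff n g)
    {f : PowerSeries 𝔽} (hf : Θ f ≠ 0) (i : ℕ) : (Θ ^ i) f ≠ 0 := by
  obtain ⟨n, hn⟩ : ∃ n, coeff n (Θ f) ≠ 0 := by
    by_contra h
    push Not at h
    exact hf (PowerSeries.ext (by simpa using h))
  rw [hΘ] at hn
  obtain ⟨hn1, hn2⟩ := mul_ne_zero_iff.mp hn
  intro h0
  have h := congrArg (coeff n) h0
  rw [coeff_theta_pow_apply Θ hΘ, map_zero] at h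
  exact (mul_ne_zero (pow_ne_zero i hn1) hn2) h

/-! ## §2 The arithmetic of the θ-cycle (pure bookkeeping on a sequence of filtrations `W : ℕ → ℕ`) -/

/-- **No θ-cycle from filtration `3(p+1)/4` (the LOW weight, `k = (p+1)/4`).** Let `p = 4u+3`, `u ≥ 1`, and let
`W : ℕ → ℕ` satisfy the RISING LAW «`p ∤ W(i) ⟹ W(i+1) = W(i) + p + 1`», the BOUND «`W(i+1) ≤ W(i) + p + 1` and
`W(i+1) ≡ W(i) + p + 1 (mod p−1)`», and HALF-PERIODICITY «`W(i + (p−1)/2) = W(i)` for `i ≥ 1`». Then `W(0) ≠ 3u+3`.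
Bookkeeping: `W(1) = 7u+7`, rising through residues `3u+4, …` to `W(u) = p(u+1)`; `W(u+1) = (u+1)(4u+7) − s(4u+2)` with
`s ≤ 2u+2` by non-negativity, `s = 2u+2` absurd, and for `s ≤ 2u+1` a further rise of `2u` steps makes `W(3u+1) = W(u)` read
`W(u+1) + 2u(4u+4) = p(u+1)`, absurd. [Jochnowitz1982, §1 (θ-cycles)] [folklore; lead-g12 §3.4] -/
theorem thetaCycle_contradiction_low (p u : ℕ) (hpu : p = 4 * u + 3) (hu : 1 ≤ u) (W : ℕ → ℕ)
    (hstep : ∀ i, ¬ p ∣ W i → W (i + 1) = W i + p + 1)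
    (hbound : ∀ i, W (i + 1) ≤ W i + p + 1 ∧ (p - 1) ∣ (W i + p + 1 - W (i + 1)))
    (hper : ∀ i, 1 ≤ i → W (i + p / 2) = W i)
    (h0 : W 0 = 3 * u + 3) : False := by
  subst hpu
  have hL : (4 * u + 3) / 2 = 2 * u + 1 := by omega
  have hpm : 4 * u + 3 - 1 = 4 * u + 2 := by omega
  simp only [hL] at hper
  simp only [hpm] at hbound
  -- non-divisibility from a division with remainder
  have ndvd : ∀ x c q r : ℕ, x + (4 * u + 3) * c = (4 * u + 3) * q + r → 0 < r → r < 4 * u + 3 →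
      ¬ (4 * u + 3) ∣ x := by
    intro x c q r hx hr0 hrp hdx
    have h1 : (4 * u + 3) ∣ x + (4 * u + 3) * c := dvd_add hdx (dvd_mul_right _ _)
    rw [hx] at h1
    have h2 : (4 * u + 3) ∣ r := (Nat.dvd_add_right (dvd_mul_right _ _)).mp h1
    exact absurd (Nat.le_of_dvd hr0 h2) (not_le.mpr hrp)
  -- rising runs
  have rise : ∀ a A T : ℕ, W a = A → (∀ t, t < T → ¬ (4 * u + 3) ∣ (A + t * (4 * u + 4))) →
      ∀ t, t ≤ T → W (a + t) = A + t * (4 * u + 4) := by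
    intro a A T ha hnd t
    induction t with
    | zero =>
      intro
      simpa using ha
    | succ t ih =>
      intro ht
      have h1 : W (a + t) = A + t * (4 * u + 4) := ih (Nat.le_of_succ_le ht)
      have h2 := hstep (a + t) (by rw [h1]; exact hnd t ht)
      rw [← add_assoc, h2, h1]
      ring
  -- the first step
  have hW1 : W 1 = 7 * u + 7 := by
    have h := hstep 0 (by
      rw [h0]
      exact ndvd _ 0 0 (3 * u + 3) (by ring) (by omega) (by omega))
    rw [Nat.zero_add] at h
    rw [h, h0]; ring
  -- the rise to the multiple of `p`
  have hWu : W u = (4 * u + 3) * (u + 1) := by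
    have h := rise 1 (7 * u + 7) (u - 1) hW1
      (fun t ht => ndvd _ 0 (1 + t) (3 * u + 4 + t) (by ring) (by omega) (by omega)) (u - 1) le_rfl
    rw [show 1 + (u - 1) = u by omega] at h
    rw [h]
    obtain ⟨v, rfl⟩ : ∃ v, u = v + 1 := ⟨u - 1, by omega⟩
    rw [Nat.add_sub_cancel]
    ring
  -- the one unknown drop
  obtain ⟨hle, hdv⟩ := hbound u
  rw [hWu] at hle hdv
  obtain ⟨s, hs⟩ := hdv
  have hv : W (u + 1) + (4 * u + 2) * s = (4 * u + 3) * (u + 1) + (4 * u + 3) + 1 := by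
    have := (Nat.sub_eq_iff_eq_add hle).mp hs
    linarith
  rcases le_or_gt s (2 * u + 1) with hs1 | hs2
  · -- `s ≤ 2u+1`: rise for `2u` more steps, then periodicity is absurd
    have hnd : ∀ t, t < 2 * u → ¬ (4 * u + 3) ∣ (W (u + 1) + t * (4 * u + 4)) := by
      intro t ht
      refine ndvd _ s (u + 2 + t) (1 + s + t) ?_ (by omega) (by omega)
      linear_combination hv
    have h := rise (u + 1) (W (u + 1)) (2 * u) rfl hnd (2 * u) le_rfl
    have hp' := hper u hu
    rw [show u + (2 * u + 1) = u + 1 + 2 * u by ring, h, hWu] at hp'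
    nlinarith [hp', hu, Nat.mul_le_mul hu hu]
  · -- `s ≥ 2u+2`: the drop overshoots zero
    have : (4 * u + 2) * (2 * u + 2) ≤ (4 * u + 2) * s := Nat.mul_le_mul_left _ hs2
    nlinarith [hv, this, hu, Nat.mul_le_mul hu hu]

/-- **No θ-cycle from filtration `(5p+1)/4` or `(p+5)/4` (the HIGH weight, `k = (3p−1)/4`).** Let `p = 4u+3`, `u ≥ 1`, and let
`W : ℕ → ℕ` satisfy the RISING LAW and HALF-PERIODICITY of `thetaCycle_contradiction_low`. Then `W(0) ∉ {5u+4, u+2}`: from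
`W(1) ∈ {9u+8, 5u+6}` the residues `u+2, …, 3u+2` resp. `u+3, …, 3u+3` stay in `(0, p)` for `2u+1` steps, so
`W(1 + (p−1)/2) = W(1) + (2u+1)(4u+4) ≠ W(1)`. (The residues `1, …, (p+1)/2` are «forbidden» on a θ-cycle of half period
`(p−1)/2`.) [Jochnowitz1982, §1 (θ-cycles)] [folklore; lead-g12 §3.4] -/
theorem thetaCycle_contradiction_high (p u : ℕ) (hpu : p = 4 * u + 3) (hu : 1 ≤ u) (W : ℕ → ℕ)
    (hstep : ∀ i, ¬ p ∣ W i → W (i + 1) = W i + p + 1)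
    (hper : ∀ i, 1 ≤ i → W (i + p / 2) = W i)
    (h0 : W 0 = 5 * u + 4 ∨ W 0 = u + 2) : False := by
  subst hpu
  have hL : (4 * u + 3) / 2 = 2 * u + 1 := by omega
  simp only [hL] at hper
  have ndvd : ∀ x c q r : ℕ, x + (4 * u + 3) * c = (4 * u + 3) * q + r → 0 < r → r < 4 * u + 3 →
      ¬ (4 * u + 3) ∣ x := by
    intro x c q r hx hr0 hrp hdx
    have h1 : (4 * u + 3) ∣ x + (4 * u + 3) * c := dvd_add hdx (dvd_mul_right _ _)
    rw [hx] at h1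
    have h2 : (4 * u + 3) ∣ r := (Nat.dvd_add_right (dvd_mul_right _ _)).mp h1
    exact absurd (Nat.le_of_dvd hr0 h2) (not_le.mpr hrp)
  have rise : ∀ a A T : ℕ, W a = A → (∀ t, t < T → ¬ (4 * u + 3) ∣ (A + t * (4 * u + 4))) →
      ∀ t, t ≤ T → W (a + t) = A + t * (4 * u + 4) := by
    intro a A T ha hnd t
    induction t with
    | zero =>
      intro
      simpa using ha
    | succ t ih =>
      intro ht
      have h1 : W (a + t) = A + t * (4 * u + 4) := ih (Nat.le_of_succ_le ht)
      have h2 := hstep (a + t) (by rw [h1]; exact hnd t ht)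
      rw [← add_assoc, h2, h1]
      ring
  have hW1 : W 1 = W 0 + (4 * u + 4) := by
    have h := hstep 0 (by
      rcases h0 with h0 | h0 <;> rw [h0]
      · exact ndvd _ 0 1 (u + 1) (by ring) (by omega) (by omega)
      · exact ndvd _ 0 0 (u + 2) (by ring) (by omega) (by omega))
    rw [Nat.zero_add] at h
    rw [h]; ring
  have hnd : ∀ t, t < 2 * u + 1 → ¬ (4 * u + 3) ∣ (W 1 + t * (4 * u + 4)) := by
    intro t ht
    rcases h0 with h0 | h0
    · refine ndvd _ 0 (2 + t) (u + 2 + t) ?_ (by omega) (by omega)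
      rw [hW1, h0]; ring
    · refine ndvd _ 0 (1 + t) (u + 3 + t) ?_ (by omega) (by omega)
      rw [hW1, h0]; ring
  have h := rise 1 (W 1) (2 * u + 1) rfl hnd (2 * u + 1) le_rfl
  have hp' := hper 1 le_rfl
  rw [h] at hp'
  have hpos : 0 < (2 * u + 1) * (4 * u + 4) := by positivity
  linarith

/-! ## §3 The theorem: both Legendre classes carry a non-zero coefficient -/

/-- **The θ-cycle engine of `stub_atP` (lead-g12 §3.4 (T4), IN THE KERNEL modulo the printed filtration calculus taken as
hypotheses).** Let `p ≥ 7`, `p ≡ 3 (mod 4)`, `𝔽` a field of characteristic `p`. Let `M j ⊆ 𝔽⟦q⟧` (`j : ℕ`) be `𝔽`-subspaces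
(«the `q`-expansions of mod-`p` modular forms of weight `j`»), `w : 𝔽⟦q⟧ → ℕ` («the filtration») and `Θ : 𝔽⟦q⟧ →ₗ 𝔽⟦q⟧` an
operator with `Θ(∑ aₙ qⁿ) = ∑ n aₙ qⁿ` (`hΘ`), such that: (`hfil`) a non-zero `g ∈ M j` has `w g ≤ j` and `j ≡ w g (mod p−1)`
[Katz1973, Cor. 4.4.2; SwinnertonDyer1973, §3 Thm. 2]; (`hfil_mem`) `g ∈ M (w g)` (the filtration is attained); (`hM0`) `M 0`
consists of constants; (`hΘ_mem`) `Θ` maps `M j` to `M (j + p + 1)` [Katz1977, Thm. (1)]; (`hKatz`) a non-zero `g ∈ M j` with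
`p ∤ w g` has `Θ g ≠ 0` and `w (Θ g) = w g + p + 1` [Katz1977, Thm. (2)]. THEN every non-zero `f ∈ M (k + (p+1)/2)` with
`k ∈ {(p+1)/4, (3p−1)/4}` and zero constant term has, for each `ε ∈ {1, −1}`, some index `n` with Legendre symbol `(n/p) = ε`
and `n`-th coefficient `≠ 0`. Proof: §1 (half-period relation under the contrary assumption) + Katz's rising law + the
arithmetic of §2. For the line: fed with (T1) «the `m`-cut Cohen–Eisenstein series `×θ₀(Q²z)^p` lies in such an `M (k + (p+1)/2)`
with these coefficients» this is (AtP⁶) = `stub_atP` up to the elementary descent of lead-g12 §3.3; no hypothesis is discharged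
here (typing owed for `Γ₁(N)`, `p ∤ N`). Not claimed: anything about BSD. [Katz1977, Thm. (1)–(2) (LNM 601 p. 55)]
[Katz1973, §4.4] [SwinnertonDyer1973, §3] [Jochnowitz1982, §1] [AhlgrenBoylan2003, Thm. 3] -/
theorem exists_coeff_ne_zero_of_legendreSym_eq
    {p : ℕ} [Fact p.Prime] (h7 : 7 ≤ p) (hp4 : p % 4 = 3) [CharP 𝔽 p]
    (M : ℕ → Submodule 𝔽 (PowerSeries 𝔽)) (w : PowerSeries 𝔽 → ℕ)
    (Θ : PowerSeries 𝔽 →ₗ[𝔽] PowerSeries 𝔽)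
    (hΘ : ∀ (g : PowerSeries 𝔽) (n : ℕ), coeff n (Θ g) = (n : 𝔽) * coeff n g)
    (hfil : ∀ (g : PowerSeries 𝔽) (j : ℕ), g ∈ M j → g ≠ 0 → w g ≤ j ∧ (p - 1) ∣ (j - w g))
    (hfil_mem : ∀ (g : PowerSeries 𝔽) (j : ℕ), g ∈ M j → g ≠ 0 → g ∈ M (w g))
    (hM0 : ∀ g ∈ M 0, g = C (constantCoeff g))
    (hΘ_mem : ∀ (g : PowerSeries 𝔽) (j : ℕ), g ∈ M j → Θ g ∈ M (j + p + 1))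
    (hKatz : ∀ (g : PowerSeries 𝔽) (j : ℕ), g ∈ M j → g ≠ 0 → ¬ p ∣ w g →
      Θ g ≠ 0 ∧ w (Θ g) = w g + p + 1)
    {k : ℕ} (hk : k = (p + 1) / 4 ∨ k = (3 * p - 1) / 4)
    {f : PowerSeries 𝔽} (hf : f ∈ M (k + (p + 1) / 2)) (hf0 : f ≠ 0) (hc0 : constantCoeff f = 0)
    {ε : ℤ} (hε : ε = 1 ∨ ε = -1) :
    ∃ n : ℕ, legendreSym p n = ε ∧ coeff n f ≠ 0 := by
  by_contra hcon
  push Not at hcon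
  -- `p = 4u + 3`, `u ≥ 1`
  obtain ⟨u, hpu⟩ : ∃ u, p = 4 * u + 3 := ⟨p / 4, by omega⟩
  have hu : 1 ≤ u := by omega
  have hp1 : p - 1 = 4 * u + 2 := by omega
  -- scalar invariance of the filtration
  have w_smul : ∀ (c : 𝔽) (g : PowerSeries 𝔽) (j : ℕ), c ≠ 0 → g ∈ M j → g ≠ 0 →
      w (c • g) = w g := by
    intro c g j hc hg hg0
    have hcg0 : c • g ≠ 0 := smul_ne_zero hc hg0
    have h1 : c • g ∈ M (w g) := (M (w g)).smul_mem c (hfil_mem g j hg hg0)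
    have h2 : g ∈ M (w (c • g)) := by
      have := (M (w (c • g))).smul_mem c⁻¹ (hfil_mem (c • g) j ((M j).smul_mem c hg) hcg0)
      rwa [smul_smul, inv_mul_cancel₀ hc, one_smul] at this
    exact le_antisymm (hfil _ _ h1 hcg0).1 (hfil _ _ h2 hg0).1
  -- the iterates are forms of weight `κ + i (p+1)`
  have hform : ∀ i, (Θ ^ i) f ∈ M (k + (p + 1) / 2 + i * (p + 1)) := by
    intro i
    induction i with
    | zero => simpa using hf
    | succ i ih =>
      have h := hΘ_mem _ _ ih
      have e : k + (p + 1) / 2 + (i + 1) * (p + 1) = k + (p + 1) / 2 + i * (p + 1) + p + 1 := by ring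
      rw [pow_succ', Module.End.mul_apply, e]
      exact h
  -- the filtration of `f`
  obtain ⟨hwle, hwdvd⟩ := hfil f _ hf hf0
  have hwf0 : w f ≠ 0 := by
    intro hw0
    have hmem : f ∈ M 0 := hw0 ▸ hfil_mem f _ hf hf0
    have h := hM0 f hmem
    rw [hc0, map_zero] at h
    exact hf0 h
  have hcases : (k + (p + 1) / 2 = 3 * u + 3 ∧ w f = 3 * u + 3) ∨
      (k + (p + 1) / 2 = 5 * u + 4 ∧ (w f = 5 * u + 4 ∨ w f = u + 2)) := by
    rcases hk with hk | hk
    · left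
      have hκ : k + (p + 1) / 2 = 3 * u + 3 := by omega
      refine ⟨hκ, ?_⟩
      rw [hκ] at hwle hwdvd
      rw [hp1] at hwdvd
      by_contra hne
      have hpos : 0 < 3 * u + 3 - w f := by omega
      have := Nat.le_of_dvd hpos hwdvd
      omega
    · right
      have hκ : k + (p + 1) / 2 = 5 * u + 4 := by omega
      refine ⟨hκ, ?_⟩
      rw [hκ] at hwle hwdvd
      rw [hp1] at hwdvd
      obtain ⟨c, hc⟩ := hwdvd
      have hc2 : c ≤ 1 := by
        by_contra h
        push Not at h
        have : (4 * u + 2) * 2 ≤ (4 * u + 2) * c := Nat.mul_le_mul_left _ h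
        omega
      interval_cases c <;> omega
  have hndvd0 : ¬ p ∣ w f := by
    rcases hcases with ⟨-, hw⟩ | ⟨-, hw | hw⟩
    · rw [hw]
      exact Nat.not_dvd_of_pos_of_lt (by omega) (by omega)
    · rw [hw, show 5 * u + 4 = p + (u + 1) by omega]
      intro h
      exact Nat.not_dvd_of_pos_of_lt (by omega : 0 < u + 1) (by omega : u + 1 < p)
        ((Nat.dvd_add_right (dvd_refl p)).mp h)
    · rw [hw]
      exact Nat.not_dvd_of_pos_of_lt (by omega) (by omega)
  -- `Θ f ≠ 0`, hence all iterates are non-zero forms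
  have hΘf : Θ f ≠ 0 := (hKatz f _ hf hf0 hndvd0).1
  have hne : ∀ i, (Θ ^ i) f ≠ 0 := theta_pow_apply_ne_zero Θ hΘ hΘf
  -- the rising law, the bound, the half-periodicity for `W i := w (Θ^i f)`
  have hstep : ∀ i, ¬ p ∣ w ((Θ ^ i) f) → w ((Θ ^ (i + 1)) f) = w ((Θ ^ i) f) + p + 1 := by
    intro i hi
    have h := (hKatz _ _ (hform i) (hne i) hi).2
    rw [pow_succ', Module.End.mul_apply]
    exact h
  have hbound : ∀ i, w ((Θ ^ (i + 1)) f) ≤ w ((Θ ^ i) f) + p + 1 ∧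
      (p - 1) ∣ (w ((Θ ^ i) f) + p + 1 - w ((Θ ^ (i + 1)) f)) := by
    intro i
    have hg := hfil_mem _ _ (hform i) (hne i)
    have hΘg := hΘ_mem _ _ hg
    have hne' : Θ ((Θ ^ i) f) ≠ 0 := by
      rw [← Module.End.mul_apply, ← pow_succ']
      exact hne (i + 1)
    have h := hfil _ _ hΘg hne'
    rw [pow_succ', Module.End.mul_apply]
    exact h
  have hper : ∀ i, 1 ≤ i → w ((Θ ^ (i + p / 2)) f) = w ((Θ ^ i) f) := by
    intro i hi
    have key := theta_pow_add_div_two_eq_neg_smul Θ hΘ hε hcon hi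
    rw [key]
    refine w_smul _ _ _ ?_ (hform i) (hne i)
    rcases hε with h | h <;> simp [h]
  -- the arithmetic of §2
  rcases hcases with ⟨-, hw⟩ | ⟨-, hw⟩
  · exact thetaCycle_contradiction_low p u hpu hu (fun i => w ((Θ ^ i) f)) hstep hbound hper
      (by simpa using hw)
  · exact thetaCycle_contradiction_high p u hpu hu (fun i => w ((Θ ^ i) f)) hstep hper
      (by simpa using hw)

end Summit.BirchSwinnertonDyer.BirchSwinnertonDyer.Theorems.PrintCFram.ThetaCycle

end
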